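import Summits.RiemannHypothesis.RiemannHypothesis.Theses.SpectralTrace
import Summits.RiemannHypothesis.RiemannHypothesis.Theorems.SpectralTraceWindowCompactness
import HarnessLib

/-!
# `WindowStep` — negative lemma: the step collapses to `WindowTraceArch → RH`

Refuter crux-attack record for the crux `stmt-RiemannHypothesis-14659`
(`Summit.RiemannHypothesis.RiemannHypothesis.Theses.SpectralTrace.WindowStep`), the "engine" binder
of route SpectralTrace: `∀ n ≥ 2, Trace(log n) → Trace(log (n+1))`, where `Trace(A)` says that some
real family `γ` reproduces the Weil functional on the Weil tests supported in `[-A, A]`.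

Two facts already in the tree make the rung index cosmetic:

* `Trace` is ANTITONE in the window (`windowTrace_anti`: a family serving `[-A', A']` serves every
  `[-A, A]`, `A ≤ A'`), so the hypothesis `Trace(log n)` at ANY `n ≥ 2` contains the seed
  `WindowTraceArch = Trace(log 2)` (`seed_of_rung`);
* the ladder `∀ A > 0, Trace(A)` is RH (`riemannHypothesis_of_ladder`) and RH gives every window
  (`spectralThesis_of_riemannHypothesis`), so the conclusion at EVERY `n` is implied by RH.

Consequences (all kernel-checked below, sorry-free):

* `windowStep_iff_windowTraceArch_imp_riemannHypothesis : WindowStep ↔ (WindowTraceArch → RH)` —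
  **the crux restates the summit modulo the seed**: in the deciding theorem
  `closes (hArch) (hStep) (hLadder) (hA)` the binder `hStep` is logically equivalent to
  `hArch → Summit.RiemannHypothesis`;
* `windowStep_iff_windowTraceArch_imp_spectralThesis : WindowStep ↔ (WindowTraceArch → X)`;
* `not_windowStep_iff : ¬ WindowStep ↔ (WindowTraceArch ∧ ¬ RH)` — a refutation of the step is a
  disproof of RH that spares the archimedean rung; `not_riemannHypothesis_of_not_windowStep`;
* `windowTraceArch_and_windowStep_iff_riemannHypothesis : (WindowTraceArch ∧ WindowStep) ↔ RH`
  (the route's own remark "Arch ∧ Step ↔ ladder ↔ RH");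
* `rung_iff_windowTraceArch_of_windowStep` : under the step every rung `Trace(log n)`, `n ≥ 2`, is
  equivalent to the seed — in particular `WindowTracePrime2 ↔ WindowTraceArch`
  (`windowTracePrime2_iff_windowTraceArch_of_windowStep`).

No new `Prop` definitions are introduced: the window-trace shape is spelled by a file-local
notation `WTrace A`.
-/

noncomputable section

open Complex Set

namespace Summit.RiemannHypothesis.RiemannHypothesis.Theorems.WindowStep.Negative

open Literature.NumberTheory.LFunctions
open Summit.RiemannHypothesis.RiemannHypothesis.Theses.SpectralTrace
open Summit.RiemannHypothesis.RiemannHypothesis.Theorems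

/-- File-local spelling of "Trace(A)": some real family reproduces `W` on the Weil tests supported
in `[-A, A]` (the common shape of `WindowTraceArch`, `WindowTracePrime2`, `WindowStep`,
`WindowCompactness`). A notation, not a definition. -/
local notation3 "WTrace " A:max => ∃ (ι : Type) (γ : ι → ℝ), ∀ g : ℝ → ℂ, IsWeilTest g →
  tsupport g ⊆ Set.Icc (-A) A →
    HasSum (fun i => weilMellin g (1 / 2 + (γ i : ℂ) * I)) (weilFunctional g)

/-- The window trace is antitone in the window: a family for `[-A', A']` serves `[-A, A]`,
`A ≤ A'`. [folklore] -/
theorem windowTrace_anti {A A' : ℝ} (hAA' : A ≤ A') (h : WTrace A') : WTrace A := by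
  obtain ⟨ι, γ, hγ⟩ := h
  exact ⟨ι, γ, fun g hg hgs => hγ g hg (hgs.trans (Icc_subset_Icc (neg_le_neg hAA') hAA'))⟩

/-- Under RH every window has a trace family (the zero ordinates with multiplicity,
`spectralThesis_of_riemannHypothesis`). [folklore] -/
theorem windowTrace_of_riemannHypothesis (hRH : _root_.RiemannHypothesis) (A : ℝ) : WTrace A := by
  obtain ⟨ι, γ, hγ⟩ := spectralThesis_of_riemannHypothesis hRH
  exact ⟨ι, γ, fun g hg _ => hγ g hg⟩

/-- Any rung `Trace(log n)`, `n ≥ 2`, contains the seed `Trace(log 2)` (which is, definitionally,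
`WindowTraceArch`). [folklore] -/
theorem seed_of_rung {n : ℕ} (hn : 2 ≤ n) (h : WTrace (Real.log n)) : WTrace (Real.log 2) :=
  windowTrace_anti (Real.log_le_log (by norm_num) (by exact_mod_cast hn)) h

/-- Seed + step give every integer rung (`Nat.le_induction`; the cast `((n+1 : ℕ) : ℝ) = n + 1`
is `Nat.cast_succ`). [folklore] -/
theorem rungs_of_windowTraceArch_of_windowStep (hArch : WindowTraceArch) (hStep : WindowStep) :
    ∀ n : ℕ, 2 ≤ n → WTrace (Real.log n) := by
  intro n hn
  induction n, hn using Nat.le_induction with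
  | base =>
    simp only [Nat.cast_ofNat]
    exact hArch
  | succ k hk ih =>
    rw [Nat.cast_succ]
    exact hStep k hk ih

/-- Seed + step give the whole ladder (integer rungs dominate every window, `log n → ∞`).
[folklore] -/
theorem ladder_of_windowTraceArch_of_windowStep (hArch : WindowTraceArch) (hStep : WindowStep) :
    ∀ A : ℝ, 0 < A → WTrace A := by
  intro A _
  obtain ⟨n, hn⟩ := exists_nat_ge (Real.exp A)
  refine windowTrace_anti ?_ (rungs_of_windowTraceArch_of_windowStep hArch hStep (n + 2) (by omega))
  rw [Real.le_log_iff_exp_le (by positivity)]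
  push_cast
  linarith

/-- Seed + step prove RH (ladder, then `riemannHypothesis_of_ladder`). [folklore] -/
theorem riemannHypothesis_of_windowTraceArch_of_windowStep (hArch : WindowTraceArch)
    (hStep : WindowStep) : _root_.RiemannHypothesis :=
  riemannHypothesis_of_ladder fun A hA => ladder_of_windowTraceArch_of_windowStep hArch hStep A hA

/-- **MAIN (the crux restates the target modulo the seed).** `WindowStep` is logically
equivalent to `WindowTraceArch → RH`. (→) seed + step ⇒ ladder ⇒ RH; (←) the hypothesis
`Trace(log n)` contains the seed, hence RH, hence every window. [folklore] -/
theorem windowStep_iff_windowTraceArch_imp_riemannHypothesis :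
    WindowStep ↔ (WindowTraceArch → _root_.RiemannHypothesis) := by
  constructor
  · intro hStep hArch
    exact riemannHypothesis_of_windowTraceArch_of_windowStep hArch hStep
  · intro h n hn hTn
    exact windowTrace_of_riemannHypothesis (h (seed_of_rung hn hTn)) _

/-- The same with the summit spelling `Summit.RiemannHypothesis`. [folklore] -/
theorem windowStep_iff_windowTraceArch_imp_summit :
    WindowStep ↔ (WindowTraceArch → Summit.RiemannHypothesis) :=
  windowStep_iff_windowTraceArch_imp_riemannHypothesis

/-- The same with the route target `X = SpectralThesis`. [folklore] -/
theorem windowStep_iff_windowTraceArch_imp_spectralThesis :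
    WindowStep ↔ (WindowTraceArch → SpectralThesis) := by
  rw [windowStep_iff_windowTraceArch_imp_riemannHypothesis]
  exact ⟨fun h hA => spectralThesis_of_riemannHypothesis (h hA),
    fun h hA => by
      obtain ⟨ι, γ, hγ⟩ := h hA
      exact riemannHypothesis_of_ladder fun A _ => ⟨ι, γ, fun g hg _ => hγ g hg⟩⟩

/-- The same with the ladder: the step is "seed → every window". [folklore] -/
theorem windowStep_iff_windowTraceArch_imp_ladder :
    WindowStep ↔ (WindowTraceArch → ∀ A : ℝ, 0 < A → WTrace A) := by
  rw [windowStep_iff_windowTraceArch_imp_riemannHypothesis]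
  exact ⟨fun h hA A _ => windowTrace_of_riemannHypothesis (h hA) A,
    fun h hA => riemannHypothesis_of_ladder fun A hA' => h hA A hA'⟩

/-- What a refutation of `WindowStep` would be: the seed together with `¬ RH`. [folklore] -/
theorem not_windowStep_iff :
    ¬ WindowStep ↔ (WindowTraceArch ∧ ¬ _root_.RiemannHypothesis) := by
  rw [windowStep_iff_windowTraceArch_imp_riemannHypothesis, Classical.not_imp]

/-- `WindowStep` is RH-implied (contrapositive form): refuting it disproves RH. [folklore] -/
theorem not_riemannHypothesis_of_not_windowStep (h : ¬ WindowStep) : ¬ _root_.RiemannHypothesis :=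
  (not_windowStep_iff.1 h).2

/-- Seed and step together are exactly RH (the route's remark "Arch ∧ Step ↔ ladder ↔ RH").
[folklore] -/
theorem windowTraceArch_and_windowStep_iff_riemannHypothesis :
    (WindowTraceArch ∧ WindowStep) ↔ _root_.RiemannHypothesis := by
  rw [windowStep_iff_windowTraceArch_imp_riemannHypothesis]
  exact ⟨fun h => h.2 h.1, fun h => ⟨windowTrace_of_riemannHypothesis h _, fun _ => h⟩⟩

/-- Under the step no rung is a new statement: every `Trace(log n)`, `n ≥ 2`, is equivalent to
the seed. [folklore] -/
theorem rung_iff_windowTraceArch_of_windowStep (hStep : WindowStep) {n : ℕ} (hn : 2 ≤ n) :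
    (WTrace (Real.log n)) ↔ WindowTraceArch :=
  ⟨seed_of_rung hn, fun hA => rungs_of_windowTraceArch_of_windowStep hA hStep n hn⟩

/-- In particular, under the step the first arithmetic rung is equivalent to the archimedean
one. [folklore] -/
theorem windowTracePrime2_iff_windowTraceArch_of_windowStep (hStep : WindowStep) :
    WindowTracePrime2 ↔ WindowTraceArch := by
  have h := rung_iff_windowTraceArch_of_windowStep hStep (n := 3) (by norm_num)
  simp only [Nat.cast_ofNat] at h
  exact h

/-- The first instance `n = 2` of the step is exactly `WindowTraceArch → WindowTracePrime2`.
[folklore] -/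
theorem windowStep_two_iff :
    ((WTrace (Real.log (2 : ℕ))) → WTrace (Real.log ((2 : ℕ) + 1))) ↔
      (WindowTraceArch → WindowTracePrime2) := by
  norm_num [WindowTraceArch, WindowTracePrime2]

end Summit.RiemannHypothesis.RiemannHypothesis.Theorems.WindowStep.Negative

end
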